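import Summits.QuantumFields.BalabanUV.Beta.FP.TowerFWoundParities

/-!
# `BalabanUV.Beta.FP.TowerFWoundParitiesW` — road «FP», binder row D1, ROUTE T, the (H5-F) option (3a) (road A-4, journal [D1P3-G62-A4]; an2 g85 W-3 (a), W-5 (3)):
# **THE END's WOUND F-FAMILY PARITY LETTERS `hWFm hWFt` FOR ANY STEP WEIGHT FAMILY** — road g58 `TowerFWoundParities` §1(second half)–§2 with `wStep Lc (n+1) ↦ w n`
# (generator ×4, names `… ↦ …_w`; the fibre-block letter `dressW_apply_inr_inr_WN` was ALREADY weight-generic and is imported BY NAME)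

WHY (journal an2 g85 W-3 (a) ∕ W-5 (3)).  Under (3a) the END's second-order F-family is `scaleK σ′ σ′ (Lc⁸ • dressW (Lc^(n+1)) Lc (w n) (WN ctr Pn n))` at the renormalised true
weight `w n := fun c μ p => (α n)⁻¹ * wF Lc Q ℓ sn n c μ p` (an2 PART 96∕97) and its wound even half on the box; v10's binders `hWFm` (no `μμ` block) and `hWFt` (the
(field, multiplier) border is the anti-twin of the (multiplier, field) border) are discharged at the record by g58's `hWFm_rec ∕ hWFt_rec` — AT `wStep`.  THIS FILE repeats them token
for token at a generic `w` (no property of `w` used: `WN_inr_inr` and GAN24's graded evenness of the wound even half carry the parities).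

WHAT ([folklore] BY NAME; no `def`, no `def … : Prop`, nothing cited, 0 sorry): §1 `FRecW_inr_inr_w`; §2 **`hWFm_rec_w`**, **`hWFt_rec_w`** — v10's binder texts under
σ = {`(𝒲bF (n+1)) B` ↦ the wound even half of `scaleK σ′ σ′ (Lc⁸ • dressW (Lc^(n+1)) Lc (w n) (WN ctr Pn n))` on the box `Mb`}.
WHAT THIS IS NOT: not the weight (PART 96); nothing of Bałaban's asserted, valued or discharged; 0 estimates; 0∕4 row-D1 binders (hW, hR, D1Tel, D1Rep); NOT (C1), NOT (T-ID), NOT D1,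
NEVER «G-an2-4 closed», NOT BetaPertH, NOT continuum, NOT Clay.

HONEST DEPENDENCY (page 1, mandatory): continuum YM on T⁴ ⇐ BetaPertH ∧ nine spine estimates (0/9 proved); BetaPertH ⇐ (D1) ∧ (D4) ∧ CAP+tail;
G-an2-4 gates asym, D1 and NE2/3/4.  HONEST FRAMING (cell contract, verbatim): «discharging `BetaPertH` makes Bałaban's UV stability UNCONDITIONAL —
a real constructive-QFT result; it is NOT the continuum limit and NOT the Clay problem.»  ABSOLUTE RULE (cell charter, verbatim): «No internally-minted
statement may enter as a cited fact. Every hypothesis is either kernel-proved in this package or a verbatim quotation of a PUBLISHED theorem with page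
reference. The manuscript(s) under audit are NOT citable for their own disputed steps — they are the thing under adjudication; programme-internal
(2001/route/tribunal) claims are never citable.»  Road «FP» OWNER, b2b-balaban-beta-d1-p3 gen 62, 2026-08-30.  No existing file touched.
-/

noncomputable section

open scoped BigOperators

namespace Summit.QuantumFields.BalabanUV.Beta.FP.TowerFWoundParitiesW

open Literature.MathematicalPhysics.QuantumFieldTheory
open Literature.MathematicalPhysics.QuantumFieldTheory.Balaban1983to89
open Literature.MathematicalPhysics.QuantumFieldTheory.Balaban1983to89.Beta
open B4TorusKernel.MultiPeriod (translate)
open B6Lemma24Torus (pbox)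
open ExpKernelCalculus (Site MKer)
open DressedMomentNormalisation (EKer)
open HessKerRate (scaleK scaleK_apply)
open HessianTelescopingKKT (wStep)
open OneStepResolventKernel (Fib)
open Summit.QuantumFields.BalabanUV.Beta.TameKernelCalculus (trK)
open Summit.QuantumFields.BalabanUV.Beta.BorderedHessian (sgnK)
open Summit.QuantumFields.BalabanUV.Beta.GAN24.SecondOrderReadersParity (parityEven_evenHalf)
open Summit.QuantumFields.BalabanUV.Beta.CompositeOneShotJetData (Roots Pins WN)
open Summit.QuantumFields.BalabanUV.Beta.NVertexParitiesW (WN_inr_inr)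
open Summit.QuantumFields.BalabanUV.Beta.FP.KernelPeriodisationFib (Idx perF)
open Summit.QuantumFields.BalabanUV.Beta.FP.KernelPeriodisationFibLoc (dper)
open Summit.QuantumFields.BalabanUV.Beta.FP.KernelStepDressing (dressW dressW_apply)
open Summit.QuantumFields.BalabanUV.Beta.FP.WoundEvenFamilyParities (parityEven_tsum inr_inr_tsum_eq_zero inr_inr_evenHalf_eq_zero
  perF_dper_apply_eq_zero_of_inr_inr perF_dper_antitwin_fμ_of_parityEven)
open Summit.QuantumFields.BalabanUV.Beta.FP.TowerFWoundParities (dressW_apply_inr_inr_WN)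

variable {Lc : ℕ} [NeZero Lc] (R : Roots Lc) (P : Pins)

/-! ## §1 The END's dressed second-order family at a generic weight has no `μμ` block -/

section Pointwise

variable (uF : ℕ → ℝ) (w : ℕ → EKer (3 + 1)) (n : ℕ)

/-- [folklore] the END's dressed second-order family `scaleK σ′ σ′ (Lc⁸ • dressW …)` has no `μμ` block. -/
theorem FRecW_inr_inr_w (μ : Fin (3 + 1)) (y : Site (3 + 1)) (ν : Fin (3 + 1)) (y' x z : Site (3 + 1)) (m m' : Fin (3 + 1)) :
    scaleK (Sum.elim (fun _ : Fin (3 + 1) => (1 : ℝ)) (fun _ : Fin (3 + 1) => (uF n))) (Sum.elim (fun _ : Fin (3 + 1) => (1 : ℝ)) (fun _ : Fin (3 + 1) => (uF n)))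
        ((Lc : ℝ) ^ 8 • dressW (Lc ^ (n + 1)) Lc (w n) (WN (Roots.ctr Lc) P n) μ y ν y') x z (Sum.inr m) (Sum.inr m') = 0 := by
  rw [scaleK_apply]
  simp only [Pi.smul_apply, smul_eq_mul, dressW_apply_inr_inr_WN, mul_zero, zero_mul]

end Pointwise

/-! ## §2 THE TWO LETTERS at the wound even dressed family -/

section Record

variable (Lc) (Pn : Pins) (uF : ℕ → ℝ) (w : ℕ → EKer (3 + 1)) {M : Fin (3 + 1) → ℕ} (Mb : Fin (3 + 1) → ℕ) {ι : Type*} (f : ι → Idx M (Fib 3))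
  (hf : ∀ a : ι, ∃ m : Fin (3 + 1), (f a).2 = Sum.inr m)
include hf

/-- [folklore] **`hWFm` AT THE RECORD** — v10's binder `hWFm` (L.248) with `(𝒲bF (n + 1)) B` ↦ the WOUND EVEN half of the σ′-scaled `Lc⁸ •` dressed `WN` (box `Mb` in place of
`Mc B`) and a generic multiplier-valued index map: on two such indices the periodised family VANISHES. -/
theorem hWFm_rec_w (n : ℕ) (μ : Fin (3 + 1)) (y : Fin (3 + 1) → ℤ) (ν : Fin (3 + 1)) (y' : Fin (3 + 1) → ℤ) (a a' : ι) :
    (perF M (dper M ((fun μ y ν y' => (fun x z a b => ∑' e : Site (3 + 1), ((1 / 2 : ℝ) • ((fun μ y ν y' => scaleK (Sum.elim (fun _ : Fin (3 + 1) => (1 : ℝ)) (fun _ : Fin (3 + 1) => (uF n))) (Sum.elim (fun _ : Fin (3 + 1) => (1 : ℝ)) (fun _ : Fin (3 + 1) => (uF n))) ((Lc : ℝ) ^ 8 • dressW (Lc ^ (n + 1)) Lc (w n) (WN (Roots.ctr Lc) Pn n) μ y ν y')) μ y ν (translate Mb y' e) + sgnK (trK ((fun μ y ν y' => scaleK (Sum.elim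 (fun _ : Fin (3 + 1) => (1 : ℝ)) (fun _ : Fin (3 + 1) => (uF n))) (Sum.elim (fun _ : Fin (3 + 1) => (1 : ℝ)) (fun _ : Fin (3 + 1) => (uF n))) ((Lc : ℝ) ^ 8 • dressW (Lc ^ (n + 1)) Lc (w n) (WN (Roots.ctr Lc) Pn n) μ y ν y')) μ y ν (translate Mb y' e))))) x z a b)) μ y ν y'))) (f a) (f a') = 0 :=
  perF_dper_apply_eq_zero_of_inr_inr M f hf
    (fun x z m m' => inr_inr_tsum_eq_zero _ (fun e x' z' m₁ m₂ => inr_inr_evenHalf_eq_zero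
      (fun x'' z'' m₃ m₄ => FRecW_inr_inr_w Pn uF w n μ y ν (translate Mb y' e) x'' z'' m₃ m₄) x' z' m₁ m₂) x z m m') a a'

/-- [folklore] **`hWFt` AT THE RECORD** — v10's binder `hWFt` (L.249) under the same σ: the (field, multiplier) border is the ANTI-twin of the (multiplier, field) border
(graded-evenness of the wound even half: road `parityEven_tsum` over GAN24 `parityEven_evenHalf`). -/
theorem hWFt_rec_w (n : ℕ) (μ : Fin (3 + 1)) (y : Fin (3 + 1) → ℤ) (ν : Fin (3 + 1)) (y' : Fin (3 + 1) → ℤ) (b : ↥(pbox M) × Fin (3 + 1)) (a : ι) :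
    (perF M (dper M ((fun μ y ν y' => (fun x z a b => ∑' e : Site (3 + 1), ((1 / 2 : ℝ) • ((fun μ y ν y' => scaleK (Sum.elim (fun _ : Fin (3 + 1) => (1 : ℝ)) (fun _ : Fin (3 + 1) => (uF n))) (Sum.elim (fun _ : Fin (3 + 1) => (1 : ℝ)) (fun _ : Fin (3 + 1) => (uF n))) ((Lc : ℝ) ^ 8 • dressW (Lc ^ (n + 1)) Lc (w n) (WN (Roots.ctr Lc) Pn n) μ y ν y')) μ y ν (translate Mb y' e) + sgnK (trK ((fun μ y ν y' => scaleK (Sum.elim (fun _ : Fin (3 + 1) => (1 : ℝ)) (fun _ : Fin (3 + 1) => (uF n))) (Sum.elim (fun _ : Fin (3 + 1) => (1 : ℝ)) (fun _ : Fin (3 + 1) => (uF n))) ((Lc : ℝ) ^ 8 • dressW (Lc ^ (n + 1)) Lc (w n) (WN (Roots.ctr Lc) Pn n) μ y ν y')) μ y ν (translate Mb y' e))))) x z a b)) μ y ν y'))) (b.1, Sum.inl b.2) (f a) = -((perF M (dper M ((fun μ y ν y' => (fun x z a b => ∑' e : Site (3 + 1), ((1 / 2 : ℝ) • ((fun μ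 y ν y' => scaleK (Sum.elim (fun _ : Fin (3 + 1) => (1 : ℝ)) (fun _ : Fin (3 + 1) => (uF n))) (Sum.elim (fun _ : Fin (3 + 1) => (1 : ℝ)) (fun _ : Fin (3 + 1) => (uF n))) ((Lc : ℝ) ^ 8 • dressW (Lc ^ (n + 1)) Lc (w n) (WN (Roots.ctr Lc) Pn n) μ y ν y')) μ y ν (translate Mb y' e) + sgnK (trK ((fun μ y ν y' => scaleK (Sum.elim (fun _ : Fin (3 + 1) => (1 : ℝ)) (fun _ : Fin (3 + 1) => (uF n))) (Sum.elim (fun _ : Fin (3 + 1) => (1 : ℝ)) (fun _ : Fin (3 + 1) => (uF n))) ((Lc : ℝ) ^ 8 • dressW (Lc ^ (n + 1)) Lc (w n) (WN (Roots.ctr Lc) Pn n) μ y ν y')) μ y ν (translate Mb y' e))))) x z a b)) μ y ν y'))) (f a) (b.1, Sum.inl b.2)) :=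
  perF_dper_antitwin_fμ_of_parityEven M f hf (parityEven_tsum _ fun _ => parityEven_evenHalf _) b a

end Record

end Summit.QuantumFields.BalabanUV.Beta.FP.TowerFWoundParitiesW

end
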